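/-
COR-CM (cell pub-hodgecm2, stage 2 of the Hodge ladder) — Δ2 BRIDGE, ORIENTATION AUDIT, **TEST T1** (ORIENTATION-MEMO v1.3 §4,
coordinator re-point 2026-08-23T21:10Z), wall-breaker seat wb-6 (prover-pub-hodgecm2-d2bridge-wb-6-g0-0), STRUCTURAL route:
unfold `cmClasses` / `geomClass` to the generators `f^* α_d` and read the Hodge type off the record `d` itself.
THEOREMS ONLY; nothing landed is edited or restated; no named fact, no `sorry`, explicit per-theorem binders.
FRAMING: HC_CM is NOT proved; «Δ2 BRIDGE CLOSED» is NOT claimed.  This file makes chain link (C) of the memo a tree theorem; it decides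
nothing about links (D)/(E).
-/
import Summits.HodgeConjecture.HodgeCM.Model.LiuDictionaryPin
import Literature.AlgebraicGeometry.HodgeTheory.DegreeOneHodgeTypes
import Literature.AlgebraicGeometry.HodgeTheory.HodgeTypeExteriorProduct
import Literature.AlgebraicGeometry.HodgeTheory.AbelianVarietyHodgeHomFullness
import HarnessLib

/-!
# Δ2 bridge, orientation audit T1: the dictionary's CM classes at a `PhiMu` line are of Hodge type `(1,0)`

The (J3) dictionary `T : LiuDictionary hHD hI h₁ h₃ V` generates, at level `Γ` and index `μ`, the set
`T.cmClasses Γ μ = ⋃_{d, T.adm μ d} {f^*_ℂ α_d | f : P_Γ ⟶ A_d}` (`LiuDictionary.cmClasses`, `geomClass Γ d f = (f^* ⊗ ℂ) d.α`) inside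
`ℂ ⊗_ℚ H¹(P_Γ(ℂ); ℚ)`, `P_Γ = U.pms L ι₁ V Γ` the tree surface.  For the PINNED dictionary `liuDictionaryPin … V I line` the admissibility
predicate is `adm i d := d.IsReflexOfTypeG ι₁ (line i).lineType` and `PhiMu i := ι₁ ∈ ((line i).lineType).1` (`LiuDictionaryInstanceLevel`,
`JLiuHermLineType`).  This file proves, in the kernel and with no hypothesis beyond the dictionary's own universe rows:

* `LiuCMSide.isOfHodgeType_oneZero_α` — a CM record `d` whose eigencharacter lies in its CM type (`d.τ ∈ d.ΦA`) has its class `α_d`, read in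
  `H¹(A_d(ℂ); ℂ)` through `β = ofRatClassBaseChangeEquiv`, of Hodge type `(1,0)` (`IsCMTypeRealisation`, clause `σ ∈ Φ`, on the `τ`-eigenline;
  `map_eigenline_complexify` moves `d.α_mem` across `β`); twin `isOfHodgeType_zeroOne_α` for `d.τ ∉ d.ΦA`.
* `LiuDictionary.isOfHodgeType_oneZero_geomClass` — hence every generator `f^*_ℂ α_d` is of type `(1,0)` on `P_Γ` (pull-backs preserve Hodge
  types, `IsOfHodgeType.map_of_isSmoothProjective`; `β` is natural, `complexBetti_map_ofRatClassBaseChangeEquiv`).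
* `LiuDictionary.tau_mem_cmType_of_isReflexOfType` — `d.IsReflexOfType ι₁ Φ → ι₁ ∈ Φ → d.τ ∈ d.ΦA` (the orientation lemma of own-crow g93's
  audit file `OrientationReflexConj.lean` §4, re-proved here in 3 steps so that this test is self-contained: witness `g = 1 ∈ S̃*`).
* **`LiuDictionary.map_span_cmClasses_le_hodgeOneZero`** — for ANY dictionary `T`, level `Γ`, index `μ` and CM type `Φ` with `ι₁ ∈ Φ` such that
  every `T.adm μ`-admissible record is `(ι₁, Φ)`-admissible (`d.IsReflexOfType ι₁ Φ`):
  `β (span_ℂ (T.cmClasses Γ μ)) ≤ H^{1,0}(P_Γ)` (`hodgeOneZero`), i.e. `span (cmClasses Γ μ) ≤ F¹`.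
* **`map_span_cmClasses_liuDictionaryPin_le_hodgeOneZero`** — THE T1 STATEMENT at the pinned dictionary of record: for `L/ℚ` Galois, any
  enumeration `(I, line)`, any level `Γ` and any index line `i` with `PhiMuLine ι₁ (line i)`:
  `β (span_ℂ ((liuDictionaryPin … V I line).cmClasses Γ i)) ≤ hodgeOneZero`, and the elementwise form
  `isOfHodgeType_oneZero_of_mem_span_cmClasses_liuDictionaryPin`.

This is chain link (C) of ORIENTATION-MEMO v1.3 §3.1 as a tree theorem.  It says nothing about `block i` (link (D) needs the S1 reading at
the geometric pin `ῑ₁`); T2 consumes it.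

References: [Liu2021] Y. Liu, arXiv:2102.11518, Def. 4.3 (TeX ll. 1914–1921); [Shimura1998] §5.2 pp. 36–37, §8.3 Prop. 28;
[VoisinHodgeI2002] §7.1.1, §7.3.2.
-/

set_option autoImplicit false

noncomputable section

namespace Summit.HodgeConjecture.CorCM.D2Bridge

open scoped TensorProduct Pointwise
open NumberField CategoryTheory
open Literature.AlgebraicGeometry.Motives (CMType IsSmoothProjective bettiCohomology)
open Literature.AlgebraicGeometry.HodgeTheory
open Literature.AlgebraicGeometry.ComplexMultiplication (IsCMTypeRealisation)
open Literature.NumberTheory.Automorphic.PicardCM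
open Literature.NumberTheory.ComplexMultiplication
open HodgeCM HodgeCM.Model
open HodgeCM.Model.LiuCMSide (autImage reflexFieldOf reflexTypeC autSet)

/-! ## §1 The record: `d.τ ∈ d.ΦA` puts `α_d` in `H^{1,0}(A_d)` -/

namespace LiuCMSideHodge

/-- The class `α_d` of a CM record, read in `H¹(A_d(ℂ); ℂ)` through `β`, lies on the `τ`-eigenline of `θA`
(`d.α_mem` transported across `β` by `map_eigenline_complexify`). [cite: Shimura1998, §5.2 (pp. 36–37)] -/
theorem β_α_mem_eigenline (d : LiuCMSide) :
    ofRatClassBaseChangeEquiv d.isRealisation.1 1 d.α ∈ eigenline d.θA d.τ := by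
  rw [← HodgeCM.CM.CommonReflex.map_eigenline_complexify d.isRealisation.1 d.θA d.isRealisation.isInducedOnIntegers d.τ]
  exact Submodule.mem_map_of_mem d.α_mem

/-- **A record whose eigencharacter lies in its CM type carries a `(1,0)`-class**: `d.τ ∈ d.ΦA → β α_d ∈ H^{1,0}(A_d)`
(`IsCMTypeRealisation`, clause `σ ∈ Φ`). [cite: Shimura1998, §5.2 (pp. 36–37)] -/
theorem isOfHodgeType_oneZero_α (d : LiuCMSide) (hτ : d.τ ∈ d.ΦA.1) :
    IsOfHodgeType (Module.finrank ℚ d.M / 2) d.A.X 1 1 0 (ofRatClassBaseChangeEquiv d.isRealisation.1 1 d.α) :=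
  (d.isRealisation.2.2.2 d.τ).2.1 hτ _ (β_α_mem_eigenline d)

/-- Twin: `d.τ ∉ d.ΦA → β α_d ∈ H^{0,1}(A_d)` (`IsCMTypeRealisation`, clause `σ ∉ Φ`). [cite: Shimura1998, §5.2 (pp. 36–37)] -/
theorem isOfHodgeType_zeroOne_α (d : LiuCMSide) (hτ : d.τ ∉ d.ΦA.1) :
    IsOfHodgeType (Module.finrank ℚ d.M / 2) d.A.X 1 0 1 (ofRatClassBaseChangeEquiv d.isRealisation.1 1 d.α) :=
  (d.isRealisation.2.2.2 d.τ).2.2 hτ _ (β_α_mem_eigenline d)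

end LiuCMSideHodge

/-! ## §2 The orientation lemma (own-crow g93, ORIENTATION-MEMO §1; re-proved for self-containedness) -/

section Orientation

variable {L : CMField} (ι₁ : L →+* ℂ)

/-- `1 ∈ autSet ι₁ Φ ↔ ι₁ ∈ Φ`. [folklore] -/
theorem one_mem_autSet_iff' (Φ : CMType L) : (1 : L ≃ₐ[ℚ] L) ∈ autSet ι₁ Φ ↔ ι₁ ∈ Φ.1 := by
  change ι₁.comp (1 : L ≃ₐ[ℚ] L).toRingEquiv.toRingHom ∈ Φ.1 ↔ ι₁ ∈ Φ.1
  exact Iff.of_eq (congrArg (fun χ => χ ∈ Φ.1) (RingHom.ext fun _ => rfl))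

/-- `ι₁ ∘ incl ∈ reflexTypeC ι₁ (autSet ι₁ Φ)` as soon as `ι₁ ∈ Φ` (witness `g = 1 ∈ S̃*`). [cite: Shimura1998, §8.3 Prop. 28] -/
theorem comp_algebraMap_mem_reflexTypeC_of_mem' (Φ : CMType L) (hι : ι₁ ∈ Φ.1) :
    ι₁.comp (algebraMap (↥(reflexFieldOf (autSet ι₁ Φ))) L) ∈ reflexTypeC ι₁ (autSet ι₁ Φ) := by
  refine ⟨1, ?_, RingHom.ext fun _ => rfl⟩
  rw [mem_reflexLift, inv_one, one_smul]
  exact ⟨1, (one_mem_autSet_iff' ι₁ Φ).2 hι, rfl⟩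

/-- **Orientation of admissible records** (own-crow g93, ORIENTATION-MEMO v1.3 §1): if `d` is admissible for `Φ` through `ι₁`
(`d.IsReflexOfType ι₁ Φ`, [Liu2021] Def. 4.3 read inside `L`) and `ι₁ ∈ Φ` (the dictionary's `PhiMu`), then `d.τ ∈ d.ΦA`.
[cite: Liu2021, Definition 4.3 (TeX ll. 1914–1921)] [cite: Shimura1998, §8.3 Prop. 28] -/
theorem tau_mem_cmType_of_isReflexOfType' (d : LiuCMSide) (Φ : CMType L) (h : d.IsReflexOfType ι₁ Φ) (hι : ι₁ ∈ Φ.1) :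
    d.τ ∈ d.ΦA.1 := by
  obtain ⟨ε, h1, h2⟩ := h
  refine (d.hΦA d.τ).2 ?_
  rw [h2, h1]
  have hcomp : ((ι₁.comp (algebraMap (↥(reflexFieldOf (autSet ι₁ Φ))) L)).comp ε.toRingHom).comp ε.symm.toRingHom =
      ι₁.comp (algebraMap (↥(reflexFieldOf (autSet ι₁ Φ))) L) :=
    RingHom.ext fun x => by
      simp only [RingHom.coe_comp, Function.comp_apply, RingEquiv.toRingHom_eq_coe, RingHom.coe_coe, RingEquiv.apply_symm_apply]
  rw [hcomp]
  exact comp_algebraMap_mem_reflexTypeC_of_mem' ι₁ Φ hι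

end Orientation

/-! ## §3 The dictionary: generators and their span -/

namespace LiuDictionaryHodge

variable {hHD : exists_isReal_hodgeModel} {hI : hodgePQ_independent_of_hodgeModel}
  {h₁ : BallQuotientUniformised} {h₃ : CMAbelianVarietyRealised}
  {L : CMField} {ι₁ : L →+* ℂ} {V : HermSpace3 L ι₁}

/-- The tree surface `P_Γ = U.pms L ι₁ V Γ` is smooth projective of dimension `2` (universe clause). [folklore] -/
theorem isSmoothProjective_pmsScheme (Γ : Level V) :
    IsSmoothProjective 2 (pmsRealisation (ballQuotientUniformisedDatum_of h₁) (pmsCode L ι₁ V Γ)).X :=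
  (pmsRealisation (ballQuotientUniformisedDatum_of h₁) (pmsCode L ι₁ V Γ)).isSmoothProjective

/-- **Every generator `f^*_ℂ α_d` of a record with `d.τ ∈ d.ΦA` is of Hodge type `(1,0)` on `P_Γ`** (pull-backs preserve Hodge types;
`β` is natural). [cite: VoisinHodgeI2002, §7.3.2] -/
theorem isOfHodgeType_oneZero_geomClass (Γ : Level V) (d : LiuCMSide) (hτ : d.τ ∈ d.ΦA.1)
    (f : (pmsRealisation (ballQuotientUniformisedDatum_of h₁) (pmsCode L ι₁ V Γ)).X ⟶ d.A.X) :
    IsOfHodgeType 2 (pmsRealisation (ballQuotientUniformisedDatum_of h₁) (pmsCode L ι₁ V Γ)).X 1 1 0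
      (ofRatClassBaseChangeEquiv (isSmoothProjective_pmsScheme (h₁ := h₁) Γ) 1
        (LiuDictionary.geomClass (hHD := hHD) (hI := hI) (h₁ := h₁) (h₃ := h₃) Γ d f)) := by
  change IsOfHodgeType 2 _ 1 1 0 (ofRatClassBaseChangeEquiv (isSmoothProjective_pmsScheme (h₁ := h₁) Γ) 1
    ((bettiCohomology.map f 1).hom.baseChange ℂ d.α))
  rw [← complexBetti_map_ofRatClassBaseChangeEquiv (isSmoothProjective_pmsScheme (h₁ := h₁) Γ) d.isRealisation.1 f d.α]
  exact (LiuCMSideHodge.isOfHodgeType_oneZero_α d hτ).map_of_isSmoothProjective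
    (isSmoothProjective_pmsScheme (h₁ := h₁) Γ) d.isRealisation.1 f

/-- Twin: a record with `d.τ ∉ d.ΦA` generates `(0,1)`-classes. [cite: VoisinHodgeI2002, §7.3.2] -/
theorem isOfHodgeType_zeroOne_geomClass (Γ : Level V) (d : LiuCMSide) (hτ : d.τ ∉ d.ΦA.1)
    (f : (pmsRealisation (ballQuotientUniformisedDatum_of h₁) (pmsCode L ι₁ V Γ)).X ⟶ d.A.X) :
    IsOfHodgeType 2 (pmsRealisation (ballQuotientUniformisedDatum_of h₁) (pmsCode L ι₁ V Γ)).X 1 0 1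
      (ofRatClassBaseChangeEquiv (isSmoothProjective_pmsScheme (h₁ := h₁) Γ) 1
        (LiuDictionary.geomClass (hHD := hHD) (hI := hI) (h₁ := h₁) (h₃ := h₃) Γ d f)) := by
  change IsOfHodgeType 2 _ 1 0 1 (ofRatClassBaseChangeEquiv (isSmoothProjective_pmsScheme (h₁ := h₁) Γ) 1
    ((bettiCohomology.map f 1).hom.baseChange ℂ d.α))
  rw [← complexBetti_map_ofRatClassBaseChangeEquiv (isSmoothProjective_pmsScheme (h₁ := h₁) Γ) d.isRealisation.1 f d.α]
  exact (LiuCMSideHodge.isOfHodgeType_zeroOne_α d hτ).map_of_isSmoothProjective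
    (isSmoothProjective_pmsScheme (h₁ := h₁) Γ) d.isRealisation.1 f

/-- **`span (cmClasses Γ μ) ≤ F¹` for `(ι₁, Φ)`-admissible records with `ι₁ ∈ Φ`** — for ANY real-carrier dictionary `T` at `(L, ι₁, V)`:
if every record admissible for `μ` is the reflex side of `Φ` through `ι₁` and `ι₁ ∈ Φ`, then `β (span_ℂ (T.cmClasses Γ μ)) ≤ H^{1,0}(P_Γ)`.
[cite: Liu2021, Definition 4.3 (TeX ll. 1914–1921)] [cite: VoisinHodgeI2002, §7.1.1 and §7.3.2] -/
theorem map_span_cmClasses_le_hodgeOneZero (T : LiuDictionary hHD hI h₁ h₃ V) (Γ : Level V) (μ : T.Char) (Φ : CMType L)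
    (hadm : ∀ d : LiuCMSide, T.adm μ d → d.IsReflexOfType ι₁ Φ) (hΦ : ι₁ ∈ Φ.1) :
    (Submodule.span ℂ (T.cmClasses Γ μ)).map
        (ofRatClassBaseChangeEquiv (isSmoothProjective_pmsScheme (h₁ := h₁) Γ) 1).toLinearMap ≤
      hodgeOneZero (isSmoothProjective_pmsScheme (h₁ := h₁) Γ) := by
  refine Submodule.map_le_iff_le_comap.2 (Submodule.span_le.2 fun x hx => ?_)
  simp only [LiuDictionary.cmClasses, Set.mem_iUnion, Set.mem_range] at hx
  obtain ⟨d, hd, f, rfl⟩ := hx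
  exact isOfHodgeType_oneZero_geomClass Γ d (tau_mem_cmType_of_isReflexOfType' ι₁ d Φ (hadm d hd) hΦ) f

/-- Elementwise form: every vector of `span_ℂ (T.cmClasses Γ μ)` is of Hodge type `(1,0)` on `P_Γ` (read through `β`).
[cite: VoisinHodgeI2002, §7.1.1 and §7.3.2] -/
theorem isOfHodgeType_oneZero_of_mem_span_cmClasses (T : LiuDictionary hHD hI h₁ h₃ V) (Γ : Level V) (μ : T.Char) (Φ : CMType L)
    (hadm : ∀ d : LiuCMSide, T.adm μ d → d.IsReflexOfType ι₁ Φ) (hΦ : ι₁ ∈ Φ.1)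
    {x : ℂ ⊗[ℚ] bettiCohomology (pmsRealisation (ballQuotientUniformisedDatum_of h₁) (pmsCode L ι₁ V Γ)).X 1}
    (hx : x ∈ Submodule.span ℂ (T.cmClasses Γ μ)) :
    IsOfHodgeType 2 (pmsRealisation (ballQuotientUniformisedDatum_of h₁) (pmsCode L ι₁ V Γ)).X 1 1 0
      (ofRatClassBaseChangeEquiv (isSmoothProjective_pmsScheme (h₁ := h₁) Γ) 1 x) :=
  (mem_hodgeOneZero _).1 (map_span_cmClasses_le_hodgeOneZero T Γ μ Φ hadm hΦ (Submodule.mem_map_of_mem hx))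

end LiuDictionaryHodge

/-! ## §4 T1 at the pinned dictionary of record -/

section Pin

open Literature.NumberTheory.Transcendental (Arapura2012_Cor_15_4_6)

variable {L : CMField} {ι₁ : (L : Type) →+* ℂ}

/-- **T1 (ORIENTATION-MEMO v1.3 §4), at the PINNED DICTIONARY `liuDictionaryPin … V I line`**: for `L/ℚ` Galois, any enumeration
`(I, line)`, any level `Γ` and any index line `i` with `PhiMuLine ι₁ (line i)` (`ι₁ ∈ Φ^δ(a_i)`), the image under
`β : ℂ ⊗ H¹(P_Γ; ℚ) ≃ H¹(P_Γ(ℂ); ℂ)` of `span_ℂ (cmClasses Γ i)` lies in `H^{1,0}(P_Γ)`: the dictionary's CM classes at a `PhiMu`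
line are HOLOMORPHIC.  (`adm i d := d.IsReflexOfTypeG ι₁ (line i).lineType` unfolds by `Iff.rfl`; the Galois guard is discharged by the
instance.) [cite: Liu2021, Definition 4.3 (TeX ll. 1914–1921)] [cite: VoisinHodgeI2002, §7.1.1 and §7.3.2] -/
theorem map_span_cmClasses_liuDictionaryPin_le_hodgeOneZero [IsGalois ℚ L]
    (hHD : exists_isReal_hodgeModel) (hI : hodgePQ_independent_of_hodgeModel)
    (h₁ : BallQuotientUniformised) (h₃ : CMAbelianVarietyRealised) (hA : Arapura2012_Cor_15_4_6)
    (V : HermSpace3 L ι₁) (I : Type) (line : I → SplitLineE V) (Γ : Level V) (i : I)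
    (hi : SplitLine.PhiMuLine ι₁ (line i)) :
    (Submodule.span ℂ ((liuDictionaryPin hHD hI h₁ h₃ hA V I line).cmClasses Γ i)).map
        (ofRatClassBaseChangeEquiv (LiuDictionaryHodge.isSmoothProjective_pmsScheme (h₁ := h₁) Γ) 1).toLinearMap ≤
      hodgeOneZero (LiuDictionaryHodge.isSmoothProjective_pmsScheme (h₁ := h₁) Γ) :=
  LiuDictionaryHodge.map_span_cmClasses_le_hodgeOneZero (liuDictionaryPin hHD hI h₁ h₃ hA V I line) Γ i (line i).lineType
    (fun d (hd : d.IsReflexOfTypeG ι₁ (SplitLine.typeOfLine (line i))) => hd inferInstance) hi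

/-- **T1, elementwise**: every vector of `span_ℂ ((liuDictionaryPin …).cmClasses Γ i)` at a `PhiMu` line is of Hodge type `(1,0)`
on `P_Γ`. [cite: Liu2021, Definition 4.3 (TeX ll. 1914–1921)] [cite: VoisinHodgeI2002, §7.1.1 and §7.3.2] -/
theorem isOfHodgeType_oneZero_of_mem_span_cmClasses_liuDictionaryPin [IsGalois ℚ L]
    (hHD : exists_isReal_hodgeModel) (hI : hodgePQ_independent_of_hodgeModel)
    (h₁ : BallQuotientUniformised) (h₃ : CMAbelianVarietyRealised) (hA : Arapura2012_Cor_15_4_6)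
    (V : HermSpace3 L ι₁) (I : Type) (line : I → SplitLineE V) (Γ : Level V) (i : I)
    (hi : SplitLine.PhiMuLine ι₁ (line i))
    {x : ℂ ⊗[ℚ] bettiCohomology (pmsRealisation (ballQuotientUniformisedDatum_of h₁) (pmsCode L ι₁ V Γ)).X 1}
    (hx : x ∈ Submodule.span ℂ ((liuDictionaryPin hHD hI h₁ h₃ hA V I line).cmClasses Γ i)) :
    IsOfHodgeType 2 (pmsRealisation (ballQuotientUniformisedDatum_of h₁) (pmsCode L ι₁ V Γ)).X 1 1 0
      (ofRatClassBaseChangeEquiv (LiuDictionaryHodge.isSmoothProjective_pmsScheme (h₁ := h₁) Γ) 1 x) :=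
  (mem_hodgeOneZero _).1
    (map_span_cmClasses_liuDictionaryPin_le_hodgeOneZero hHD hI h₁ h₃ hA V I line Γ i hi (Submodule.mem_map_of_mem hx))

end Pin

end Summit.HodgeConjecture.CorCM.D2Bridge

end
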